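import Literature.Computability.Complexity.SymbolPrograms
import HarnessLib

/-!
# Uniform flat programs and their multi-pass transcript check

Literature / complexity toolkit (the pure layer of the universal simulation behind the
nondeterministic time hierarchy theorem, `NTIMEHierarchyDiagonal.lean`). A run of a
`K`-register binary stack program is CERTIFIED by the sequence of its *observations* (which
symbol, if any, each `pop` saw); a verifier holding a single work stack checks the certificate
in `K` passes, pass `p` replaying the control flow from the claimed observations while keeping
register `p` — and only it — for real, and comparing every claimed observation on register `p`
with the actual top symbol. This is the classical linear-time nondeterministic simulation of
many tapes by few (Book–Greibach–Wegbreit 1970: guess the sequence of displays, check one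
tape at a time; Arora–Barak 2009, proof of Thm. 3.2 uses it through "NDTMs can be
simulated with constant overhead"). This file is machine-free:

* `UFlat.UInstr`, `UFlat.ustep`: *uniform* flat programs — every instruction is
  `(act, k, j₀, j₁, j₂)`: `act ∈ {0, 1}` pushes the bit `act` on register `k` and jumps to
  `j₀`; `act ≥ 2` pops register `k` and jumps to `j₀ / j₁ / j₂` on empty / `0` / `1`
  (observation codes `0 / 1 / 2`, `UFlat.obsOf`); an address beyond the program is halted;
* `UFlat.upass`, `UFlat.upassRun`: pass `p` on one claimed observation / on a list of claims
  (`none` = a claim about register `p` was refuted); `UFlat.uobs`: the true observations;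
* **completeness** `UFlat.upassRun_uobs`: on the true observations every pass succeeds and ends
  in the true (address, register `p`);
* **soundness** `UFlat.upassRun_sound`: if every pass `p < K` succeeds (all registers of the
  program being `< K`), every pass ends in the true (address, register `p`) after `|claims|`
  steps — whatever the claims;
* `UFlat.UAccepts` (all passes succeed, end halted, and the output register holds `[true]`) with
  its soundness/completeness corollaries `UFlat.halted_of_uAccepts`, `UFlat.uAccepts_uobs`;
* `UFlat.toUProg`: the programs `AProg Bool (Fin K)` of `SymbolPrograms.lean` are uniform
  programs over `K + 1` registers (`goto` = a pop of the always-empty register `K`), step for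
  step (`UFlat.ustep_toUProg`, `UFlat.iterate_ustep_toUProg`).

## References

* R. V. Book, S. A. Greibach, B. Wegbreit, *Time- and tape-bounded Turing acceptors and AFLs*,
  J. Comput. System Sci. 4 (1970) 606–621 [BookGreibachWegbreit1970] (k tapes in linear
  nondeterministic time on few tapes, by guessing and checking the sequence of displays).
* S. Arora, B. Barak, *Computational Complexity: A Modern Approach*, CUP 2009, Thm. 3.2 (proof)
  and §1.4.
-/

namespace Literature.Computability.Complexity

open Function

namespace UFlat

/-! ### Uniform flat programs -/

/-- A uniform instruction `(act, k, j₀, j₁, j₂)`: `act = 0 / 1` pushes `false / true` on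
register `k` and continues at `j₀`; `act ≥ 2` pops register `k` and continues at `j₀` (empty),
`j₁` (popped `false`) or `j₂` (popped `true`). [folklore] -/
structure UInstr where
  /-- action: `0`/`1` push that bit, `≥ 2` pop -/
  act : ℕ
  /-- register -/
  k : ℕ
  /-- target after a push, or after popping an empty register -/
  j0 : ℕ
  /-- target after popping `false` -/
  j1 : ℕ
  /-- target after popping `true` -/
  j2 : ℕ
  deriving DecidableEq, Inhabited

/-- Uniform programs. [folklore] -/
abbrev UProg : Type := List UInstr

/-- Register stores indexed by naturals. [folklore] -/
abbrev UStore : Type := ℕ → List Bool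

/-- Configurations: address and store. [folklore] -/
abbrev UCfg : Type := ℕ × UStore

/-- The observation code of a stack: `0` empty, `1` top `false`, `2` top `true`. [folklore] -/
def obsOf : List Bool → ℕ
  | [] => 0
  | false :: _ => 1
  | true :: _ => 2

/-- The target selected by an observation code. [folklore] -/
def UInstr.sel (i : UInstr) (o : ℕ) : ℕ := if o = 0 then i.j0 else if o = 1 then i.j1 else i.j2

/-- One step of a uniform program (a halted configuration is fixed). [folklore] -/
def ustep (P : UProg) (c : UCfg) : UCfg :=
  match P[c.1]? with
  | none => c
  | some i =>
    if i.act < 2 then (i.j0, update c.2 i.k (decide (i.act = 1) :: c.2 i.k))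
    else (i.sel (obsOf (c.2 i.k)), update c.2 i.k (c.2 i.k).tail)

/-- A halted configuration is a fixed point. [folklore] -/
theorem ustep_of_le {P : UProg} {c : UCfg} (h : P.length ≤ c.1) : ustep P c = c := by
  unfold ustep
  rw [List.getElem?_eq_none_iff.2 h]

/-- Hence of all iterates. [folklore] -/
theorem iterate_ustep_of_le {P : UProg} {c : UCfg} (h : P.length ≤ c.1) (t : ℕ) :
    (ustep P)^[t] c = c :=
  iterate_fixed (ustep_of_le h) t

/-- Two halted iterates of one run agree (determinism). [folklore] -/
theorem iterate_ustep_halted_unique {P : UProg} {c : UCfg} {t₁ t₂ : ℕ}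
    (h₁ : P.length ≤ ((ustep P)^[t₁] c).1) (h₂ : P.length ≤ ((ustep P)^[t₂] c).1) :
    (ustep P)^[t₁] c = (ustep P)^[t₂] c := by
  wlog h : t₁ ≤ t₂ generalizing t₁ t₂
  · exact (this h₂ h₁ (Nat.le_of_not_le h)).symm
  obtain ⟨d, rfl⟩ := Nat.exists_eq_add_of_le h
  rw [Nat.add_comm, iterate_add_apply, iterate_ustep_of_le h₁]

/-! ### Passes -/

/-- **Pass `p` on one claimed observation `o`**: replay the instruction at the current address,
keeping register `p` for real (`c.2`); a pop of register `p` checks the claim against the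
actual top symbol (`none` on a refuted claim); pops of other registers trust the claim.
[cite: AroraBarak2009, Thm. 3.2 (proof)] -/
def upass (P : UProg) (p : ℕ) (c : ℕ × List Bool) (o : ℕ) : Option (ℕ × List Bool) :=
  match P[c.1]? with
  | none => some c
  | some i =>
    if i.act < 2 then some (i.j0, if i.k = p then decide (i.act = 1) :: c.2 else c.2)
    else if i.k = p then (if o = obsOf c.2 then some (i.sel o, c.2.tail) else none)
    else some (i.sel o, c.2)

/-- Pass `p` on a list of claims. [folklore] -/
def upassRun (P : UProg) (p : ℕ) : ℕ × List Bool → List ℕ → Option (ℕ × List Bool)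
  | c, [] => some c
  | c, o :: os => (upass P p c o).bind fun c' => upassRun P p c' os

/-- The true observations of `t` steps from `c` (`0` for pushes and halted steps).
[folklore] -/
def uobs (P : UProg) : UCfg → ℕ → List ℕ
  | _, 0 => []
  | c, t + 1 =>
    (match P[c.1]? with
      | none => 0
      | some i => if i.act < 2 then 0 else obsOf (c.2 i.k)) :: uobs P (ustep P c) t

/-- The true observation sequence has one entry per step. [folklore] -/
@[simp] theorem length_uobs (P : UProg) : ∀ (c : UCfg) (t : ℕ), (uobs P c t).length = t
  | _, 0 => rfl
  | c, t + 1 => by simp [uobs, length_uobs P (ustep P c) t]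

/-- One pass step on the true observation reproduces the true step at register `p`.
[folklore] -/
theorem upass_true (P : UProg) (p : ℕ) (c : UCfg) :
    upass P p (c.1, c.2 p) (match P[c.1]? with
      | none => 0
      | some i => if i.act < 2 then 0 else obsOf (c.2 i.k)) =
      some ((ustep P c).1, (ustep P c).2 p) := by
  unfold upass ustep
  cases hP : P[c.1]? with
  | none => rfl
  | some i =>
    simp only
    by_cases ha : i.act < 2
    · simp only [if_pos ha]
      by_cases hk : i.k = p
      · subst hk; simp
      · simp [hk, update_of_ne (Ne.symm hk)]
    · simp only [if_neg ha]
      by_cases hk : i.k = p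
      · subst hk; simp
      · simp [hk, update_of_ne (Ne.symm hk)]

/-- **Completeness**: on the true observations, pass `p` succeeds and ends with the true address
and the true register `p`. [cite: AroraBarak2009, Thm. 3.2 (proof)] -/
theorem upassRun_uobs (P : UProg) (p : ℕ) : ∀ (t : ℕ) (c : UCfg),
    upassRun P p (c.1, c.2 p) (uobs P c t) =
      some (((ustep P)^[t] c).1, ((ustep P)^[t] c).2 p)
  | 0, c => rfl
  | t + 1, c => by
    rw [uobs, upassRun, upass_true, Option.bind_some, upassRun_uobs P p t (ustep P c),
      iterate_succ_apply]

/-- At a pop step, the pass of the popped register refutes every false claim. [folklore] -/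
theorem claim_eq_of_upass_isSome {P : UProg} {c : UCfg} {i : UInstr} {o : ℕ}
    (hP : P[c.1]? = some i) (ha : ¬ i.act < 2)
    (h : (upass P i.k (c.1, c.2 i.k) o).isSome) : o = obsOf (c.2 i.k) := by
  unfold upass at h
  simp only [hP, if_neg ha, if_true] at h
  by_contra hne
  simp [hne] at h

/-- If the claim at a pop step is true, every pass moves to the true next address and its
true register. [folklore] -/
theorem upass_of_claim (P : UProg) (p : ℕ) (c : UCfg) (o : ℕ)
    (ho : ∀ i, P[c.1]? = some i → ¬ i.act < 2 → o = obsOf (c.2 i.k)) :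
    upass P p (c.1, c.2 p) o = some ((ustep P c).1, (ustep P c).2 p) := by
  rw [← upass_true P p c]
  unfold upass
  cases hP : P[c.1]? with
  | none => rfl
  | some i =>
    simp only
    by_cases ha : i.act < 2
    · simp [if_pos ha]
    · rw [ho i hP ha]; simp [if_neg ha]

/-- **Soundness**: if all registers of `P` are `< K` and every pass `p < K` succeeds on the
claims `os`, then every pass ends with the true address and the true register after `|os|`
steps. [cite: AroraBarak2009, Thm. 3.2 (proof)] -/
theorem upassRun_sound {P : UProg} {K : ℕ} (hK : ∀ i ∈ P, i.k < K) : ∀ (os : List ℕ) (c : UCfg)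
    (res : ℕ → ℕ × List Bool), (∀ p < K, upassRun P p (c.1, c.2 p) os = some (res p)) →
    ∀ p < K, res p = (((ustep P)^[os.length] c).1, ((ustep P)^[os.length] c).2 p)
  | [], c, res, h, p, hp => by simpa [upassRun] using (h p hp).symm
  | o :: os, c, res, h, p, hp => by
    -- the claim `o` is true whenever it matters
    have ho : ∀ i, P[c.1]? = some i → ¬ i.act < 2 → o = obsOf (c.2 i.k) := by
      intro i hPi ha
      have hk : i.k < K := hK i (List.mem_of_getElem? hPi)
      refine claim_eq_of_upass_isSome hPi ha ?_
      have := h i.k hk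
      rw [upassRun] at this
      cases hu : upass P i.k (c.1, c.2 i.k) o with
      | none => rw [hu] at this; simp at this
      | some _ => rfl
    have h' : ∀ q < K, upassRun P q ((ustep P c).1, (ustep P c).2 q) os = some (res q) := by
      intro q hq
      have := h q hq
      rwa [upassRun, upass_of_claim P q c o ho, Option.bind_some] at this
    have ih := upassRun_sound hK os (ustep P c) res h' p hp
    rwa [List.length_cons, iterate_succ_apply]

/-! ### Acceptance -/

/-- The initial store: the word `init` on register `inp`, all other registers empty.
[folklore] -/
def initStore (inp : ℕ) (init : List Bool) : UStore := update (fun _ => []) inp init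

/-- **Acceptance by the multi-pass check**: every pass `p < K`, started from the initial
content of register `p`, succeeds on the claims, ends at a halted address, and pass `out` ends
with the word `[true]` on its register. [cite: AroraBarak2009, Thm. 3.2 (proof)] -/
def UAccepts (P : UProg) (K inp out : ℕ) (init : List Bool) (os : List ℕ) : Prop :=
  ∀ p < K, ∃ q w, upassRun P p (0, initStore inp init p) os = some (q, w) ∧ P.length ≤ q ∧
    (p = out → w = [true])

/-- **Soundness of acceptance**: an accepted claim sequence of length `t` certifies that the
true run from the initial store is halted after `t` steps with `[true]` on register `out`.
[cite: AroraBarak2009, Thm. 3.2 (proof)] -/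
theorem halted_of_uAccepts {P : UProg} {K inp out : ℕ} {init : List Bool} {os : List ℕ}
    (hK : ∀ i ∈ P, i.k < K) (hout : out < K) (h : UAccepts P K inp out init os) :
    P.length ≤ ((ustep P)^[os.length] (0, initStore inp init)).1 ∧
      ((ustep P)^[os.length] (0, initStore inp init)).2 out = [true] := by
  classical
  choose! q w hrun hq hw using h
  have hs := upassRun_sound hK os (0, initStore inp init) (fun p => (q p, w p))
    (fun p hp => hrun p hp) out hout
  simp only [Prod.mk.injEq] at hs
  exact ⟨hs.1 ▸ hq out hout, hs.2 ▸ hw out hout rfl⟩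

/-- **Completeness of acceptance**: if the true run is halted after `t` steps with `[true]` on
register `out`, the true observations are accepted (for any `K`).
[cite: AroraBarak2009, Thm. 3.2 (proof)] -/
theorem uAccepts_uobs {P : UProg} (K : ℕ) {inp out : ℕ} {init : List Bool} {t : ℕ}
    (hq : P.length ≤ ((ustep P)^[t] (0, initStore inp init)).1)
    (hw : ((ustep P)^[t] (0, initStore inp init)).2 out = [true]) :
    UAccepts P K inp out init (uobs P (0, initStore inp init) t) := by
  intro p _
  refine ⟨_, _, upassRun_uobs P p t (0, initStore inp init), hq, ?_⟩
  rintro rfl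
  exact hw

/-! ### The flat programs of `SymbolPrograms.lean` are uniform programs -/

variable {K : ℕ}

/-- Translation of an instruction at address `pc`: `push k b ↦ (b, k, pc+1, pc+1, pc+1)`,
`pop k j ↦ (2, k, j none, j (some false), j (some true))`, `goto j ↦ (2, K, j, j, j)` (a pop of
the never-written register `K`). [folklore] -/
def toU (K : ℕ) : AInstr Bool (Fin K) → ℕ → UInstr
  | .push k b, pc => ⟨b.toNat, k.val, pc + 1, pc + 1, pc + 1⟩
  | .pop k j, _ => ⟨2, k.val, j none, j (some false), j (some true)⟩
  | .goto j, _ => ⟨2, K, j, j, j⟩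

/-- Translation of a program. [folklore] -/
def toUProg (P : AProg Bool (Fin K)) : UProg := P.mapIdx fun pc i => toU K i pc

/-- The translation preserves the length. [folklore] -/
@[simp] theorem length_toUProg (P : AProg Bool (Fin K)) : (toUProg P).length = P.length := by
  simp [toUProg]

/-- The registers of the translation are `≤ K`. [folklore] -/
theorem k_lt_of_mem_toUProg {P : AProg Bool (Fin K)} {i : UInstr} (h : i ∈ toUProg P) :
    i.k < K + 1 := by
  simp only [toUProg, List.mem_mapIdx] at h
  obtain ⟨pc, hpc, rfl⟩ := h
  generalize P[pc] = x
  cases x <;> simp [toU] <;> omega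

/-- Extension of a `Fin K`-indexed store by empty registers. [folklore] -/
def ext (R : AStore Bool (Fin K)) : UStore := fun p => if h : p < K then R ⟨p, h⟩ else []

/-- Reading a genuine register of the extension. [folklore] -/
@[simp] theorem ext_apply_fin (R : AStore Bool (Fin K)) (k : Fin K) : ext R k.val = R k := by
  simp [ext]

/-- The dummy register of the extension is empty. [folklore] -/
@[simp] theorem ext_apply_K (R : AStore Bool (Fin K)) : ext R K = [] := by
  simp [ext]

/-- Extension commutes with updates of genuine registers. [folklore] -/
theorem ext_update (R : AStore Bool (Fin K)) (k : Fin K) (v : List Bool) :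
    ext (update R k v) = update (ext R) k.val v := by
  funext p
  by_cases hp : p = k.val
  · subst hp; simp
  · rw [update_of_ne hp]
    unfold ext
    by_cases h : p < K
    · rw [dif_pos h, dif_pos h, update_of_ne]
      exact fun e => hp (by rw [← e])
    · rw [dif_neg h, dif_neg h]

/-- The extension of the input store. [folklore] -/
theorem ext_single (inp : Fin K) (z : List Bool) : ext (AStore.single inp z) = initStore inp.val z := by
  rw [AStore.single_eq_update, ext_update, initStore]
  congr 1
  funext p
  simp [ext]

/-- **Step correspondence**: one step of the uniform translation on an extended configuration is
the extension of one step of the flat program. [folklore] -/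
theorem ustep_toUProg (P : AProg Bool (Fin K)) (c : ACfg Bool (Fin K)) :
    ustep (toUProg P) (c.pc, ext c.regs) = ((P.step c).pc, ext (P.step c).regs) := by
  unfold ustep AProg.step
  have hget : (toUProg P)[c.pc]? = (P[c.pc]?).map fun i => toU K i c.pc := by
    simp [toUProg, List.getElem?_mapIdx]
  rw [hget]
  cases hP : P[c.pc]? with
  | none => rfl
  | some x =>
    cases x with
    | push k b =>
      cases b <;> simp [toU, ext_update]
    | goto j =>
      have e : update (ext c.regs) K ([] : List Bool) = ext c.regs := by
        rw [← ext_apply_K c.regs, update_eq_self]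
      simp [toU, UInstr.sel, obsOf, e]
    | pop k j =>
      simp only [Option.map_some, toU, Nat.lt_irrefl, if_false, ext_apply_fin]
      cases hk : c.regs k with
      | nil =>
        have e : update (ext c.regs) k.val ([] : List Bool) = ext c.regs := by
          funext p
          by_cases hp : p = k.val
          · subst hp; simp [hk]
          · simp [update_of_ne hp]
        simp [UInstr.sel, obsOf, e]
      | cons b w =>
        cases b <;> simp [UInstr.sel, obsOf, ext_update]

/-- **Run correspondence.** [folklore] -/
theorem iterate_ustep_toUProg (P : AProg Bool (Fin K)) (t : ℕ) (c : ACfg Bool (Fin K)) :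
    (ustep (toUProg P))^[t] (c.pc, ext c.regs) = ((P.step^[t] c).pc, ext (P.step^[t] c).regs) := by
  induction t generalizing c with
  | zero => rfl
  | succ t ih => rw [iterate_succ_apply, iterate_succ_apply, ustep_toUProg, ih]

/-- **From a flat halting run to accepted observations** (the completeness direction used by
the diagonalizer): if the flat program runs from `⟨0, input z on inp⟩` to the halted address
`|P|` with `[true]` on register `out` in `t` steps, then the true observations of its uniform
translation (a claim list of length `t`) are accepted by the `(K+1)`-pass check.
[cite: AroraBarak2009, Thm. 3.2 (proof)] -/
theorem uAccepts_of_iterate {P : AProg Bool (Fin K)} {inp out : Fin K} {z : List Bool}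
    {R' : AStore Bool (Fin K)} {t : ℕ}
    (h : P.step^[t] ⟨0, AStore.single inp z⟩ = ⟨P.length, R'⟩) (hout : R' out = [true]) :
    UAccepts (toUProg P) (K + 1) inp.val out.val z
      (uobs (toUProg P) (0, initStore inp.val z) t) := by
  have hit := iterate_ustep_toUProg P t ⟨0, AStore.single inp z⟩
  rw [h, ext_single] at hit
  refine uAccepts_uobs (K + 1) (t := t) ?_ ?_
  · rw [hit]; simp
  · rw [hit]; simpa using hout

/-- **From accepted claims to the flat halting run** (the soundness direction): if some claim
list of length `t` is accepted for the uniform translation, then the flat program is halted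
after `t` steps from `⟨0, input z on inp⟩` with `[true]` on register `out`; in particular, if
the flat program is known to reach `⟨|P|, R'⟩` at some time, then `R' out = [true]`.
[cite: AroraBarak2009, Thm. 3.2 (proof)] -/
theorem out_eq_of_uAccepts {P : AProg Bool (Fin K)} {inp out : Fin K} {z : List Bool}
    {os : List ℕ} (hacc : UAccepts (toUProg P) (K + 1) inp.val out.val z os)
    {R' : AStore Bool (Fin K)} {t₀ : ℕ} (h₀ : P.step^[t₀] ⟨0, AStore.single inp z⟩ = ⟨P.length, R'⟩) :
    R' out = [true] := by
  have hs := halted_of_uAccepts (fun i hi => k_lt_of_mem_toUProg hi) (Nat.lt_succ_of_lt out.isLt) hacc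
  rw [length_toUProg] at hs
  have hit := iterate_ustep_toUProg P os.length ⟨0, AStore.single inp z⟩
  rw [ext_single] at hit
  have hit₀ := iterate_ustep_toUProg P t₀ ⟨0, AStore.single inp z⟩
  rw [ext_single, h₀] at hit₀
  have huniq := iterate_ustep_halted_unique (P := toUProg P) (c := (0, initStore inp.val z))
    (t₁ := os.length) (t₂ := t₀) (by rw [length_toUProg]; exact hs.1)
    (by rw [hit₀, length_toUProg])
  rw [huniq, hit₀] at hs
  simpa using hs.2

end UFlat

end Literature.Computability.Complexity
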